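import Summits.BirchSwinnertonDyer.BirchSwinnertonDyer.Theorems.ResidualThetaTransportAtTwoRlfTwistedLocalKummerCard
import Literature.NumberTheory.EllipticCurves.LocalWeilPairingDuality
import Literature.NumberTheory.EllipticCurves.ZpExtensionGaloisTwistWeilDual
import Literature.NumberTheory.GaloisCohomology.PoitouTateSelmerStructures
import Literature.NumberTheory.GaloisRepresentations.TateDualityCounting
import HarnessLib

/-!
# Route `ResidualThetaTransportAtTwo` (RTT P6, item stmt-BirchSwinnertonDyer-23110, road T), H-PLUSDUAL brick (K4):
# the `±`-duality `hdual` at `2` REDUCED TO ISOTROPY by counting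

Width seat `bsd-wall-tp2-p2x-w2` g15 (cell `bsd-wall`), for the LEAD `bsd-wall-tp2-p2x` g12. HONEST FRAMING: THEOREMS ONLY
(no definition, no named fact, no instance, no `sorry`); closes no item; `hdual` is NOT proved here (it is reduced to the isotropy
statement `hiso`, B. D. Kim 2007 Prop. 3.15 read at `2`, twisted, level `ℚ_v`); BSD is NOT proved by any of this.

The binder `hdual` of the LEAD's `TwistedPT.hlevEventual_two_of_plusDualAlt_of_eigen` (p663434, at `ε = 1`) says: at `v ∣ 2`, every
local class `y' ∈ H¹(ℚ_v, E[2^J](χ_{u'}))` whose Weil-dual image `H¹(w) y'` is orthogonal to the plus condition `L_u` lies in the plus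
condition `L_{u'}`. With the COUNTS now in the tree — `#H¹(ℚ_v, E[2^J](χ_u)) = 4^J`
(`TwistedLocalCount.natCard_galoisCohomology_one_twistedTorsion_two`) and `#L_u = #L_{u'} = 2^J`
(`TwistedLocalKummer.natCard_twistedTorsionLocalKummer_two`) — and the perfectness of the local Tate pairing (`inv.IsPerfect`) and
the bijectivity of `H¹(w)` (`exists_unique_map_twistedWeilDual_restrictField_eq`), the tree's counting lemma
`forall_mem_apply_eq_zero_iff_of_isotropic_of_card_le` (an isotropic pair `L, L'` with `#H¹ ≤ #L·#L'` is an exact annihilator pair)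
reduces `hdual` to the ISOTROPY `⟨L_u, H¹(w) L_{u'}⟩_v = 0`:

* **`plusDualAlt_of_iso`** — `hiso → hdual` (both VERBATIM in the LEAD's binder shape, `ε = 1`), for `E/ℚ` globally minimal with
  `GoodSS E 2`, `a₂(E) = 0`, `κ` cyclotomic, `u` odd.

References: B. D. Kim, Compositio Math. 143 (2007), §3.3 Props. 3.15–3.18 [BDKim2007]; J. S. Milne, *Arithmetic Duality Theorems*
I Cor. 2.3, I §3 Lemma 3.8 / Rem. 3.7 [MilneADT2006]; R. Greenberg, LNM 1716 §4 pp. 122–124 [GreenbergLNM1716]; B. Howard,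
Compositio 140 (2004) Def. 2.1.6 [Howard2004HeegnerKolyvagin].
-/

-- the Theorems namespace of this sub repeats the summit name by design (D-0017 nested layout)
set_option linter.dupNamespace false

noncomputable section

open scoped Classical NumberField
open CategoryTheory Function Field NumberField IsDedekindDomain

namespace Summit.BirchSwinnertonDyer.BirchSwinnertonDyer.Theorems.SignedEC.TwistedLocalKummer

open Literature.NumberTheory.EllipticCurves Literature.NumberTheory.GaloisRepresentations WeierstrassCurve ZpExtension
  Literature.NumberTheory.EllipticCurves.Kobayashi2003 Literature.NumberTheory.GaloisCohomology
open Literature.NumberTheory.GaloisRepresentations.DiscreteGaloisModule (localTatePairingZMod)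
open scoped ContRepresentation

/-- **H-PLUSDUAL reduced to isotropy (K4).** For `E/ℚ` globally minimal with good supersingular reduction at `2` and `a₂ = 0`,
`κ` cyclotomic and `u` odd: if for every level `J`, inverse twist `u'`, alternating non-degenerate Weil datum `e`, perfect family of
local invariants and `v ∣ 2` the plus conditions are ISOTROPIC — `⟨x, H¹(w) y'⟩_v = 0` for `x ∈ L_u`, `y' ∈ L_{u'}` — then the `hdual`
binder of `TwistedPT.hlevEventual_two_of_plusDualAlt_of_eigen` (at `ε = 1`) holds: `H¹(w) y' ⊥ L_u ⟹ y' ∈ L_{u'}`. Counting: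
`#H¹ = 4^J = #L_u · #L_{u'}`, the pairing `(y', x) ↦ ⟨x, H¹(w) y'⟩_v` has injective adjoint (local Tate duality + `H¹(w)` bijective),
so an isotropic pair of that size is an exact annihilator pair (`forall_mem_apply_eq_zero_iff_of_isotropic_of_card_le`).
[cite: BDKim2007, Prop. 3.18] [cite: MilneADT2006, Ch. I Cor. 2.3] [cite: GreenbergLNM1716, §4 pp. 123–124] -/
theorem plusDualAlt_of_iso (E : WeierstrassCurve ℚ) [E.IsElliptic] [E.IsGloballyMinimal]
    (hss : Rank1Residual.GoodSS E 2) (ha : E.frobeniusTrace 2 = 0) {κ : ZpExtension ℚ 2} (hκ : κ.IsCyclotomic)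
    (u : ℤ) (hu : (2 : ℤ) ∣ u - 1)
    (hiso : ∀ (J : ℕ) (u' : ℤ) (hu' : (2 : ℤ) ∣ u' - 1) (huu' : ((2 : ℤ) ^ J) ∣ u * u' - 1)
      (e : E.geomTorsion ((2 ^ J : ℕ) : ℤ) → E.geomTorsion ((2 ^ J : ℕ) : ℤ) → AlgebraicClosure ℚ)
      (hμ : ∀ S T, e S T ^ (2 ^ J) = 1) (hadd₁ : ∀ S₁ S₂ T, e (S₁ + S₂) T = e S₁ T * e S₂ T)
      (hadd₂ : ∀ S T₁ T₂, e S (T₁ + T₂) = e S T₁ * e S T₂)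
      (hgal : ∀ (σ : absoluteGaloisGroup ℚ) (S T : E.geomTorsion ((2 ^ J : ℕ) : ℤ)), σ • e S T = e (σ • S) (σ • T))
      (_halt : ∀ T, e T T = 1) (_hnondeg : ∀ T, (∀ S, e S T = 1) → T = 0)
      [Finite (E.geomTorsion ((2 ^ J : ℕ) : ℤ))]
      (inv : LocalInvariants ℚ (2 ^ J)), inv.IsPerfect →
      ∀ (v : HeightOneSpectrum (𝓞 ℚ)), ((2 : ℕ) : 𝓞 ℚ) ∈ v.asIdeal →
      ∀ x ∈ E.twistedTorsionLocalKummer 2 κ J u hu (v.adicCompletion ℚ) (⨆ n : ℕ, signedLocalPoints κ (v.adicCompletion ℚ) E 1 n),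
      ∀ y' ∈ E.twistedTorsionLocalKummer 2 κ J u' hu' (v.adicCompletion ℚ) (⨆ n : ℕ, signedLocalPoints κ (v.adicCompletion ℚ) E 1 n),
        localTatePairingZMod (E.twistedTorsionGaloisModule 2 κ J u hu) (2 ^ J) (Sum.inr v) (inv (Sum.inr v)) x
          (galoisCohomology.map ((E.twistedWeilDual 2 κ J hu hu' huu' e hμ hadd₁ hadd₂ hgal).restrictField (v.adicCompletion ℚ)) 1
            y') = 0) :
    ∀ (J : ℕ) (u' : ℤ) (hu' : (2 : ℤ) ∣ u' - 1) (huu' : ((2 : ℤ) ^ J) ∣ u * u' - 1)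
      (e : E.geomTorsion ((2 ^ J : ℕ) : ℤ) → E.geomTorsion ((2 ^ J : ℕ) : ℤ) → AlgebraicClosure ℚ)
      (hμ : ∀ S T, e S T ^ (2 ^ J) = 1) (hadd₁ : ∀ S₁ S₂ T, e (S₁ + S₂) T = e S₁ T * e S₂ T)
      (hadd₂ : ∀ S T₁ T₂, e S (T₁ + T₂) = e S T₁ * e S T₂)
      (hgal : ∀ (σ : absoluteGaloisGroup ℚ) (S T : E.geomTorsion ((2 ^ J : ℕ) : ℤ)), σ • e S T = e (σ • S) (σ • T))
      (halt : ∀ T, e T T = 1) (hnondeg : ∀ T, (∀ S, e S T = 1) → T = 0)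
      [Finite (E.geomTorsion ((2 ^ J : ℕ) : ℤ))]
      (inv : LocalInvariants ℚ (2 ^ J)), inv.IsPerfect → inv.SumLocalTermEqZero → inv.UnramifiedOrthogonal →
      ∀ (v : HeightOneSpectrum (𝓞 ℚ)), ((2 : ℕ) : 𝓞 ℚ) ∈ v.asIdeal →
      ∀ y' : galoisCohomology ((E.twistedTorsionGaloisModule 2 κ J u' hu').restrictField (v.adicCompletion ℚ)) 1,
        galoisCohomology.map ((E.twistedWeilDual 2 κ J hu hu' huu' e hμ hadd₁ hadd₂ hgal).restrictField (v.adicCompletion ℚ)) 1 y' ∈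
            inv.dualLocalCondition (E.twistedTorsionGaloisModule 2 κ J u hu) (Sum.inr v)
              (E.twistedTorsionLocalKummer 2 κ J u hu (v.adicCompletion ℚ)
                (⨆ n : ℕ, signedLocalPoints κ (v.adicCompletion ℚ) E 1 n)) →
        y' ∈ E.twistedTorsionLocalKummer 2 κ J u' hu' (v.adicCompletion ℚ) (⨆ n : ℕ, signedLocalPoints κ (v.adicCompletion ℚ) E 1 n) := by
  intro J u' hu' huu' e hμ hadd₁ hadd₂ hgal halt hnondeg _ inv hperf _ _ v hv y₀ hy₀
  haveI : Fact (Nat.Prime 2) := ⟨Nat.prime_two⟩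
  haveI : NeZero (2 ^ J) := ⟨pow_ne_zero _ two_ne_zero⟩
  have hv' : (2 : 𝓞 ℚ) ∈ v.asIdeal := by exact_mod_cast hv
  -- the counts
  obtain ⟨-, -, hfinU, hcardU⟩ :=
    TwistedLocalCount.natCard_galoisCohomology_one_twistedTorsion_two E hss κ J u hu v hv' e hμ hadd₁ hadd₂ hgal hnondeg
  obtain ⟨-, -, hfinU', -⟩ :=
    TwistedLocalCount.natCard_galoisCohomology_one_twistedTorsion_two E hss κ J u' hu' v hv' e hμ hadd₁ hadd₂ hgal hnondeg
  haveI := hfinU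
  haveI := hfinU'
  have hcLu := natCard_twistedTorsionLocalKummer_two E hss ha hκ J u hu v hv'
  have hcLu' := natCard_twistedTorsionLocalKummer_two E hss ha hκ J u' hu' v hv'
  -- the pairing `b y x := ⟨x, H¹(w) y⟩_v` and its injectivity
  let b : galoisCohomology ((E.twistedTorsionGaloisModule 2 κ J u' hu').restrictField (v.adicCompletion ℚ)) 1 →+
      galoisCohomology ((E.twistedTorsionGaloisModule 2 κ J u hu).restrictField (v.adicCompletion ℚ)) 1 →+ ZMod (2 ^ J) :=
    (localTatePairingZMod (E.twistedTorsionGaloisModule 2 κ J u hu) (2 ^ J) (Sum.inr v) (inv (Sum.inr v))).flip.comp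
      (galoisCohomology.map ((E.twistedWeilDual 2 κ J hu hu' huu' e hμ hadd₁ hadd₂ hgal).restrictField (v.adicCompletion ℚ)) 1)
  have hb : ∀ y x, b y x = localTatePairingZMod (E.twistedTorsionGaloisModule 2 κ J u hu) (2 ^ J) (Sum.inr v) (inv (Sum.inr v)) x
      (galoisCohomology.map ((E.twistedWeilDual 2 κ J hu hu' huu' e hμ hadd₁ hadd₂ hgal).restrictField (v.adicCompletion ℚ)) 1 y) :=
    fun _ _ ↦ rfl
  have hB : ∀ x : galoisCohomology ((E.twistedTorsionGaloisModule 2 κ J u hu).restrictField (v.adicCompletion ℚ)) 1,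
      (2 ^ J) • x = 0 := fun x ↦
    nsmul_continuousCohomology_one_eq_zero _ (2 ^ J) (fun m ↦ E.pow_nsmul_geomTorsion_pow 2 J m) x
  have hinj : Function.Injective b := by
    rw [injective_iff_map_eq_zero]
    intro y hy
    have hflip : Function.Injective
        (localTatePairingZMod (E.twistedTorsionGaloisModule 2 κ J u hu) (2 ^ J) (Sum.inr v) (inv (Sum.inr v))).flip :=
      ((hperf v).2 (E.twistedTorsionGaloisModule 2 κ J u hu) (fun m ↦ E.pow_nsmul_geomTorsion_pow 2 J m)).2.1
    have h1 : (localTatePairingZMod (E.twistedTorsionGaloisModule 2 κ J u hu) (2 ^ J) (Sum.inr v) (inv (Sum.inr v))).flip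
        (galoisCohomology.map ((E.twistedWeilDual 2 κ J hu hu' huu' e hμ hadd₁ hadd₂ hgal).restrictField (v.adicCompletion ℚ)) 1
          y) = 0 := hy
    have hwy : galoisCohomology.map ((E.twistedWeilDual 2 κ J hu hu' huu' e hμ hadd₁ hadd₂ hgal).restrictField
        (v.adicCompletion ℚ)) 1 y = 0 :=
      hflip (h1.trans (AddMonoidHom.map_zero _).symm)
    obtain ⟨t, -, huniq⟩ := E.exists_unique_map_twistedWeilDual_restrictField_eq 2 κ J hu hu' huu' e hμ hadd₁ hadd₂ hgal hnondeg
      (v.adicCompletion ℚ) 0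
    rw [huniq y hwy, ← huniq 0 (AddMonoidHom.map_zero _)]
  have hcard : Nat.card (galoisCohomology ((E.twistedTorsionGaloisModule 2 κ J u hu).restrictField (v.adicCompletion ℚ)) 1) ≤
      Nat.card (E.twistedTorsionLocalKummer 2 κ J u' hu' (v.adicCompletion ℚ)
        (⨆ n : ℕ, signedLocalPoints κ (v.adicCompletion ℚ) E 1 n)) *
      Nat.card (E.twistedTorsionLocalKummer 2 κ J u hu (v.adicCompletion ℚ)
        (⨆ n : ℕ, signedLocalPoints κ (v.adicCompletion ℚ) E 1 n)) := by
    rw [hcardU, hcLu, hcLu', ← pow_add, ← two_mul, pow_mul]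
    norm_num
  have key := forall_mem_apply_eq_zero_iff_of_isotropic_of_card_le b hB hinj
    (E.twistedTorsionLocalKummer 2 κ J u' hu' (v.adicCompletion ℚ) (⨆ n : ℕ, signedLocalPoints κ (v.adicCompletion ℚ) E 1 n))
    (E.twistedTorsionLocalKummer 2 κ J u hu (v.adicCompletion ℚ) (⨆ n : ℕ, signedLocalPoints κ (v.adicCompletion ℚ) E 1 n))
    (fun y hy x hx ↦ by rw [hb]; exact hiso J u' hu' huu' e hμ hadd₁ hadd₂ hgal halt hnondeg inv hperf v hv x hx y hy) hcard y₀
  refine key.1 fun x hx ↦ ?_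
  rw [hb]
  exact (LocalInvariants.mem_dualLocalCondition_iff inv (E.twistedTorsionGaloisModule 2 κ J u hu) (Sum.inr v) _ _).1 hy₀ x hx

end Summit.BirchSwinnertonDyer.BirchSwinnertonDyer.Theorems.SignedEC.TwistedLocalKummer

end
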